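import HarnessLib.Audit.LibrarySuggestionsDenyListCorCM
import Summits.HodgeConjecture.CorCM.HypLiu418.A3Liu418GSInstance
import Literature.NumberTheory.Automorphic.Liu2021.AppendixC.HeckePushPullPackage
import HarnessLib

/-!
# The (P3) input package of a Hecke generator of the GS unitary Shimura CURVE tower (`stub_RosH` glue, (G1))

Cell `hodgecm-mathlib` (D-0151), crux `HLiu418` = stmt-HodgeConjecture-24832, d6 line `Cruxes/HLiu418/Lines/d6_cm_curve`, socket `SocketRosH`,
glue file `A3Liu418GSRosH.lean` (pen A-p02 (g14), cut (G1) 2026-08-30T05:34Z∕05:47Z).  BARE PROOF FILE: theorems only — no definition ∕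
structure ∕ instance ∕ named fact ∕ `sorry`; count-neutral: HC_CM is proved only modulo the 7 printed citations until rung 0 closes.

For the §4.2 datum `C := sec42DataGS S h4 isoₛ` with its CHOSEN translates `T := sec42HeckeTranslatesGS S hU7ₛ h4 isoₛ` (u1) and the
level-quotient universal property ★ `levelQuotientUP_GS` (u4 `hLQ`), and a generator `[Kγ₀K]`:

* **`exists_pushPull_package_GS (K) (γ₀)`** — `∃ N hNK hn Δ [Group] [Fintype] [Nonempty] (act : Δ →* Aut X⋆_N) hact (t, ht) (s, hs, hsN),
  IsSepQuotient (act ·) u^N_K`: exactly the binders of ★ (P3) `heckeEnd_eq_pushPull_of_aut` (take `fun δ => act δ` for its bare family)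
  plus the Galois clause of `u` (for (G3)'s piecewise trace word and (iv-b)) — ★ `HeckeTranslates.exists_pushPull_package` at
  `τ := ι₁`, `hUP := levelQuotientUP_GS`.  The normal sub-levels `N″_γ` of the `T_γ`-letters are ★ `C5.SmallLevel.exists_normal_sublevel_conj`
  (generic, no GS wrapper needed).

## References
* [Liu2021] Y. Liu, *Fourier–Jacobi cycles and arithmetic relative trace formula*, Camb. J. Math. 9 (2021): §4.2 (FJcycle.tex l. 2060–2074),
  p. 133 (before (D.3)).
* [Lang1983AbelianVarieties] S. Lang, *Abelian Varieties* (1983), Ch. VIII §6 Thm. 13 (pp. 224–227).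
* [Milne2005ShimuraVarieties] J. S. Milne, *Introduction to Shimura varieties* (2005), §5 p. 58 L3–11, Rem. 5.29 (c) p. 65; §13 p. 118 L21–26.
* [Bump1997] D. Bump, *Automorphic Forms and Representations* (1997), §4.2 Prop. 4.2.3.
-/

set_option autoImplicit false

noncomputable section

open CategoryTheory CategoryTheory.Limits AlgebraicGeometry NumberField MulAction
open Literature.AlgebraicGeometry.Motives
open Literature.AlgebraicGeometry.ShimuraVarieties.UnitaryCanonicalModel
open Literature.NumberTheory.Automorphic Literature.NumberTheory.Automorphic.UnitaryGroup
open Literature.NumberTheory.Automorphic.Liu2021 Literature.NumberTheory.Automorphic.Liu2021.AppendixC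

namespace Summit.HodgeConjecture.CorCM.Lines.A3Liu418

variable {F : CMField} {ι₁ : F →+* ℂ} {Jstar : Matrix (Fin 2) (Fin 2) F}
  {K₀ : C5.OpenCompactSubgroup ↥(finAdelic (↥(maximalRealSubfield F)) F (IsCMField.complexConj F) 2 Jstar)}
  (S : RecordSystemGS F Jstar ι₁ K₀)
  (hU7ₛ : S.HeckeTranslateDefinedOver) (hLQ : S.IsLevelQuotient) (h4 : 4 ≤ Module.finrank ℚ F) (isoₛ : ℕ → Prop)

include hLQ in
/-- **(G1) The (P3) input package of the Hecke generator `[Kγ₀K]` of the GS curve tower, PRODUCED from u1∕u4**: a level `N ≤ K` normalised by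
`K`, a FINITE NON-EMPTY group `Δ` acting on `X⋆_N` by the chosen translates (`hact : ∀ δ, ∃ k hk, (act δ).hom = T⋆.tr k N N _`), the Albanese
trace `t : A_K → A_N` with `Alb_u ≫ t = Σ_δ Alb(act δ)` ([Lang1983AbelianVarieties] VIII §6 Thm. 13), a transversal `s` of `Kγ₀K ∕ K` with
`γ⁻¹Nγ ⊆ K` on `s`, and `u^N_K` a quotient of `X⋆_N` by `act` for separated test objects — the binders of ★ (P3)
`heckeEnd_eq_pushPull_of_aut` verbatim (its bare family is `fun δ => act δ`). [cite: Liu2021, §4.2 (FJcycle.tex l. 2074) and p. 133 (before (D.3))]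
[cite: Lang1983AbelianVarieties, Ch. VIII §6, Thm. 13 (pp. 224–227)] [cite: Milne2005ShimuraVarieties, §5 p. 58 L3–11 and Rem. 5.29 (c) p. 65] -/
theorem exists_pushPull_package_GS (K : C5.SmallLevel K₀)
    (γ₀ : ↥(finAdelic (↥(maximalRealSubfield F)) F (IsCMField.complexConj F) 2 Jstar)) :
    ∃ (N : C5.SmallLevel K₀) (hNK : N ≤ K)
      (hn : ∀ k ∈ K.1.1, C5.HeckeLE k N N)
      (Δ : Type) (_ : Group Δ) (_ : Fintype Δ) (_ : Nonempty Δ) (act : Δ →* Aut ((sec42DataGS S h4 isoₛ).X N))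
      (_ : ∀ δ, ∃ (k : ↥(finAdelic (↥(maximalRealSubfield F)) F (IsCMField.complexConj F) 2 Jstar)) (hk : k ∈ K.1.1),
        (act δ).hom = (sec42HeckeTranslatesGS S hU7ₛ h4 isoₛ).tr k N N (hn k hk))
      (t : (sec42DataGS S h4 isoₛ).A K ⟶ (sec42DataGS S h4 isoₛ).A N)
      (_ : ((sec42DataGS S h4 isoₛ).alb N).map ((sec42DataGS S h4 isoₛ).alb K) ((sec42DataGS S h4 isoₛ).cpt.X.map (homOfLE hNK)) ≫ t =
        ∑ δ, ((sec42DataGS S h4 isoₛ).alb N).map ((sec42DataGS S h4 isoₛ).alb N) (act δ).hom)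
      (s : Finset ↥(finAdelic (↥(maximalRealSubfield F)) F (IsCMField.complexConj F) 2 Jstar))
      (_ : Set.BijOn
        (fun x : ↥(finAdelic (↥(maximalRealSubfield F)) F (IsCMField.complexConj F) 2 Jstar) =>
          (x : ↥(finAdelic (↥(maximalRealSubfield F)) F (IsCMField.complexConj F) 2 Jstar) ⧸
            (K.1.1 : Subgroup ↥(finAdelic (↥(maximalRealSubfield F)) F (IsCMField.complexConj F) 2 Jstar))))
        s (orbit K.1.1 (γ₀ : ↥(finAdelic (↥(maximalRealSubfield F)) F (IsCMField.complexConj F) 2 Jstar) ⧸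
            (K.1.1 : Subgroup ↥(finAdelic (↥(maximalRealSubfield F)) F (IsCMField.complexConj F) 2 Jstar)))))
      (_ : ∀ γ ∈ s, C5.HeckeLE γ N K),
      IsSepQuotient (fun δ => act δ) ((sec42DataGS S h4 isoₛ).cpt.X.map (homOfLE hNK)) :=
  (sec42HeckeTranslatesGS S hU7ₛ h4 isoₛ).exists_pushPull_package ι₁ (levelQuotientUP_GS S hU7ₛ hLQ h4 isoₛ) K γ₀

end Summit.HodgeConjecture.CorCM.Lines.A3Liu418

end
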